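import Summits.QuantumAdvantage.QuantumAdvantage.Theorems.CubicForrelationNearExactIsExactTwoModSixPrep

/-!
# Crux `CubicForrelation.NearExactIsExact` (stmt-QuantumAdvantage-14043) — `n = 6r+2`: the two residuals at the base level are
  Walsh-dual, `(u_g − 2^r(−1)^f)^ = −2^{3r+1}·(u_f − 2^r(−1)^g)`

Certificate seat `b2b-cforr-cert` (gen 9).  HONEST FRAMING: a two-line Fourier identity recorded as a tool for the two-sided analysis of the
second boundary on `6r+2` bits (it is what turns a type-O / all-cheap `g`-side into a "spike" constraint on the `f`-side, see the seat's
write-up `PROOF-N14-SECOND.md`, addendum); NOT summit progress.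

With `W_g = 2^{2r+1}u`, `W_f = 2^{2r+1}v` (both cubic sides sit at the common base level `2r+1 = ⌈n/3⌉`) and the residuals
`τ_g = u − 2^r(−1)^f`, `τ_f = v − 2^r(−1)^g`:  `W(τ_g)(y) = 2^{−(2r+1)}·2ⁿ(−1)^{g(y)} − 2^r W_f(y) = −2^{3r+1} τ_f(y)` (Walsh inversion,
`tz_inversion`).  Consequences recorded: `Σ τ_f² = Σ τ_g²` is the symmetry of the budget (`tms_budget` on both sides), and the pairing
`Σ_y (−1)^{g(y)} W(τ_g)(y) = −2^{3r+1} Σ_y (−1)^{g(y)} τ_f(y)` (`tm2_pairing_dual`).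

References: C. Carlet (2021) §2.3 (Walsh inversion).  Everything below is proved from the tree; axioms are the standard three.
-/

set_option linter.dupNamespace false -- D-0017: single-problem summit ⇒ `QuantumAdvantage.QuantumAdvantage` by design

noncomputable section

namespace Summit.QuantumAdvantage.QuantumAdvantage.Theorems.CubicForrelation.NearExactIsExact

open Finset
open Literature.Computability.QuantumComplexity
open Literature.Computability.QuantumComplexity.DerivativeWalsh (W)

/-- **Residual duality on `6r+2` bits.**  If `W_g = 2^{2r+1}u` and `W_f = 2^{2r+1}v` then for every `y`
`W(u − 2^r(−1)^f)(y) = −2^{3r+1}·(v(y) − 2^r(−1)^{g(y)})`.  [this work; cite: Carlet2020, §2.3 for Walsh inversion] -/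
theorem tm2_residual_dual (r : ℕ) (f g : (Fin ((3 * r + 1) + (3 * r + 1)) → Bool) → Bool)
    (u v : (Fin ((3 * r + 1) + (3 * r + 1)) → Bool) → ℤ)
    (hu : ∀ x, W (fun y => signOf (g y)) x = (2 : ℝ) ^ (2 * r + 1) * (u x : ℝ))
    (hv : ∀ y, W (fun x => signOf (f x)) y = (2 : ℝ) ^ (2 * r + 1) * (v y : ℝ)) (y : Fin ((3 * r + 1) + (3 * r + 1)) → Bool) :
    W (fun x => (u x : ℝ) - (2 : ℝ) ^ r * signOf (f x)) y = -(2 : ℝ) ^ (3 * r + 1) * ((v y : ℝ) - (2 : ℝ) ^ r * signOf (g y)) := by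
  have hinv := tz_inversion (fun y => signOf (g y)) y
  have hWf : W (fun x => signOf (f x)) y = ∑ x, signOf (f x) * twist x y := rfl
  have hL : W (fun x => (u x : ℝ) - (2 : ℝ) ^ r * signOf (f x)) y =
      ∑ x, ((u x : ℝ) * twist x y - (2 : ℝ) ^ r * (signOf (f x) * twist x y)) := by
    show ∑ x, ((u x : ℝ) - (2 : ℝ) ^ r * signOf (f x)) * twist x y = _
    exact sum_congr rfl fun x _ => by ring
  rw [hL, sum_sub_distrib, ← mul_sum, ← hWf, hv y]
  have hU : (2 : ℝ) ^ (2 * r + 1) * ∑ x, (u x : ℝ) * twist x y =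
      (2 : ℝ) ^ ((3 * r + 1) + (3 * r + 1)) * signOf (g y) := by
    rw [← hinv, mul_sum]
    exact sum_congr rfl fun x _ => by rw [hu x]; ring
  have hpow : (2 : ℝ) ^ ((3 * r + 1) + (3 * r + 1)) = 2 ^ (2 * r + 1) * 2 ^ (4 * r + 1) := by
    rw [← pow_add]; congr 1; ring
  have hU' : ∑ x, (u x : ℝ) * twist x y = (2 : ℝ) ^ (4 * r + 1) * signOf (g y) := by
    rw [hpow, mul_assoc] at hU
    exact mul_left_cancel₀ (by positivity) hU
  rw [hU']
  have e3 : (2 : ℝ) ^ (4 * r + 1) = 2 ^ (3 * r + 1) * 2 ^ r := by rw [← pow_add]; congr 1; ring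
  have e4 : (2 : ℝ) ^ r * 2 ^ (2 * r + 1) = 2 ^ (3 * r + 1) := by rw [← pow_add]; congr 1; ring
  rw [e3, ← mul_assoc ((2 : ℝ) ^ r), e4]
  ring

/-- **The budget is symmetric** (`Σ_y τ_f(y)² = Σ_x τ_g(x)²`), via `tms_budget` on both sides and `Φ(f,g) = Φ(g,f)`. [this work] -/
theorem tm2_budget_symm (r : ℕ) (f g : (Fin ((3 * r + 1) + (3 * r + 1)) → Bool) → Bool)
    (u v : (Fin ((3 * r + 1) + (3 * r + 1)) → Bool) → ℤ)
    (hu : ∀ x, W (fun y => signOf (g y)) x = (2 : ℝ) ^ (2 * r + 1) * (u x : ℝ))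
    (hv : ∀ y, W (fun x => signOf (f x)) y = (2 : ℝ) ^ (2 * r + 1) * (v y : ℝ)) :
    (∑ y, (v y - 2 ^ r * sZ (g y)) ^ 2 : ℤ) = ∑ x, (u x - 2 ^ r * sZ (f x)) ^ 2 := by
  have h1 := tms_budget r f g u hu
  have h2 := tms_budget r g f v hv
  rw [Summit.QuantumAdvantage.QuantumAdvantage.Theorems.SignedCubicForrelationNotPrBPP.Negative.HalfQuad.forrelation_comm g f, ← h1] at h2
  exact_mod_cast h2

/-- **Dual pairing.** `Σ_y (−1)^{g(y)}·W(τ_g)(y) = −2^{3r+1}·Σ_y (−1)^{g(y)} τ_f(y)`. [this work] -/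
theorem tm2_pairing_dual (r : ℕ) (f g : (Fin ((3 * r + 1) + (3 * r + 1)) → Bool) → Bool)
    (u v : (Fin ((3 * r + 1) + (3 * r + 1)) → Bool) → ℤ)
    (hu : ∀ x, W (fun y => signOf (g y)) x = (2 : ℝ) ^ (2 * r + 1) * (u x : ℝ))
    (hv : ∀ y, W (fun x => signOf (f x)) y = (2 : ℝ) ^ (2 * r + 1) * (v y : ℝ)) :
    ∑ y, signOf (g y) * W (fun x => (u x : ℝ) - (2 : ℝ) ^ r * signOf (f x)) y =
      -(2 : ℝ) ^ (3 * r + 1) * ∑ y, signOf (g y) * ((v y : ℝ) - (2 : ℝ) ^ r * signOf (g y)) := by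
  rw [mul_sum]
  exact sum_congr rfl fun y _ => by rw [tm2_residual_dual r f g u v hu hv y]; ring

end Summit.QuantumAdvantage.QuantumAdvantage.Theorems.CubicForrelation.NearExactIsExact

end
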